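import Literature.NumberTheory.LFunctions.WeilExplicit
import Mathlib.Analysis.SpecialFunctions.SmoothTransition
import Mathlib.Analysis.InnerProductSpace.Calculus
import Mathlib.Analysis.Calculus.MeanValue
import Mathlib.Data.Real.Sign

/-!
# Route OddSector, item `OddArchAnchor`: a smooth antisymmetric fold of an odd test function

Support file for item stmt-RiemannHypothesis-17781 (`OddArchAnchor`) of route `OddSector`.
Normalisation of `Literature/NumberTheory/LFunctions/WeilExplicit.lean` (test functions
`IsWeilTest g`: smooth with compact support).

For an ODD test function `g` and `η > 0` we construct an ODD TEST FUNCTION `h` ("smooth fold") with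
`tsupport h ⊆ tsupport g` which, on the half-line `x > 0`, is a `1`-Lipschitz radial image of `g`:
`h(x) = Ψ_η(g(x))` with `Ψ_η(z) = η L(|z|/η − 1)`, `L(v) = v e^{-1/v}` (`v > 0`), `L = 0` on
`(−∞, 0]`. Hence `|h(s) − h(x)| ≤ |g(s) − g(x)|` and `|h(x)| ≤ |g(x)|` for `x, s > 0` (the
hypotheses of the folded-kernel inequality), `h ≥ 0` on `(0, ∞)`, and `h` is uniformly
`2η`-close to the non-smooth fold `sign(x) |g(x)|` (`exists_smooth_fold`). Smoothness at the
origin: `Ψ_η` vanishes on the ball `|z| ≤ η`, so `Ψ_η ∘ g` vanishes near `0` and the sign factor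
can be realised by a smooth odd cutoff equal to `±1` away from `0`.

No definitions are introduced into the tree (the auxiliary functions are local to the proofs).
-/

-- `Summit.RiemannHypothesis.RiemannHypothesis.…` repeats the summit name by design (D-0017 layout).
set_option linter.dupNamespace false

noncomputable section

open Set Filter
open scoped Topology ContDiff

namespace Summit.RiemannHypothesis.RiemannHypothesis.Theorems.OddArchAnchor

open Literature.NumberTheory.LFunctions

/-! ## The profile `L(v) = v · expNegInvGlue v` -/

/-- `L(v) = v e^{-1/v} ≤ v` for `v ≥ 0` (and `L = 0` on `v ≤ 0`): `e^{-1/v} ≤ 1`. -/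
theorem mul_expNegInvGlue_le {v : ℝ} (hv : 0 ≤ v) : v * expNegInvGlue v ≤ v := by
  have h1 : expNegInvGlue v ≤ 1 := by
    rcases hv.eq_or_lt with h | h
    · rw [← h, expNegInvGlue.zero]; norm_num
    · unfold expNegInvGlue
      rw [if_neg (not_le.2 h)]
      exact Real.exp_le_one_iff.2 (by simp [h.le])
  nlinarith [expNegInvGlue.nonneg v]

/-- `v − 1 ≤ L(v) = v e^{-1/v}` (`1 − 1/v ≤ e^{-1/v}`). -/
theorem sub_one_le_mul_expNegInvGlue (v : ℝ) : v - 1 ≤ v * expNegInvGlue v := by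
  rcases le_or_gt v 0 with h | h
  · rw [expNegInvGlue.zero_of_nonpos h, mul_zero]; linarith
  · unfold expNegInvGlue
    rw [if_neg (not_le.2 h)]
    have h1 : -v⁻¹ + 1 ≤ Real.exp (-v⁻¹) := Real.add_one_le_exp _
    have h2 : v * (-v⁻¹ + 1) = v - 1 := by field_simp; ring
    nlinarith [mul_le_mul_of_nonneg_left h1 h.le]

/-- On `(0, ∞)`, `L(v) = v e^{-1/v}` has derivative `e^{-1/v} (1 + 1/v) ∈ [0, 1]`. -/
theorem hasDerivAt_mul_expNegInvGlue {v : ℝ} (hv : 0 < v) :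
    HasDerivAt (fun v ↦ v * expNegInvGlue v) (Real.exp (-v⁻¹) * (1 + v⁻¹)) v := by
  have heq : (fun w ↦ w * expNegInvGlue w) =ᶠ[𝓝 v] fun w ↦ w * Real.exp (-w⁻¹) := by
    filter_upwards [Ioi_mem_nhds hv] with w hw
    unfold expNegInvGlue
    rw [if_neg (not_le.2 (mem_Ioi.1 hw))]
  refine HasDerivAt.congr_of_eventuallyEq ?_ heq
  have h1 : HasDerivAt (fun w : ℝ ↦ -w⁻¹) (-(-(v ^ 2)⁻¹)) v := (hasDerivAt_inv hv.ne').neg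
  rw [neg_neg] at h1
  have h2 : HasDerivAt (fun w : ℝ ↦ Real.exp (-w⁻¹)) (Real.exp (-v⁻¹) * (v ^ 2)⁻¹) v :=
    h1.exp
  have h3 : HasDerivAt (fun w : ℝ ↦ w * Real.exp (-w⁻¹))
      (1 * Real.exp (-v⁻¹) + v * (Real.exp (-v⁻¹) * (v ^ 2)⁻¹)) v := (hasDerivAt_id' v).mul h2
  have hv0 : v ≠ 0 := hv.ne'
  have e : 1 * Real.exp (-v⁻¹) + v * (Real.exp (-v⁻¹) * (v ^ 2)⁻¹) =
      Real.exp (-v⁻¹) * (1 + v⁻¹) := by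
    have : v * (v ^ 2)⁻¹ = v⁻¹ := by
      rw [sq, mul_inv, ← mul_assoc, mul_inv_cancel₀ hv0, one_mul]
    rw [one_mul, mul_add, mul_one, ← this]
    ring
  rw [e] at h3
  exact h3

/-- `L(v) = v e^{-1/v}` is `1`-Lipschitz on `ℝ` (derivative in `[0,1]` on `(0,∞)`, `0 ≤ L(v) ≤ v`
across the origin, `L = 0` on `(−∞, 0]`). -/
theorem lipschitzWith_mul_expNegInvGlue : LipschitzWith 1 fun v : ℝ ↦ v * expNegInvGlue v := by
  have hpos : ∀ a b : ℝ, 0 < a → 0 < b →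
      ‖b * expNegInvGlue b - a * expNegInvGlue a‖ ≤ 1 * ‖b - a‖ := by
    intro a b ha hb
    refine Convex.norm_image_sub_le_of_norm_hasDerivWithin_le (s := Ioi (0 : ℝ))
      (f := fun v ↦ v * expNegInvGlue v) (f' := fun v ↦ Real.exp (-v⁻¹) * (1 + v⁻¹))
      (fun v hv ↦ (hasDerivAt_mul_expNegInvGlue hv).hasDerivWithinAt) (fun v (hv : 0 < v) ↦ ?_)
      (convex_Ioi 0) ha hb
    have hv' : 0 < v⁻¹ := inv_pos.2 hv
    have h1 : 0 ≤ Real.exp (-v⁻¹) * (1 + v⁻¹) := by positivity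
    rw [Real.norm_of_nonneg h1]
    have h2 : (1 + v⁻¹) ≤ Real.exp v⁻¹ := by linarith [Real.add_one_le_exp v⁻¹]
    calc Real.exp (-v⁻¹) * (1 + v⁻¹) ≤ Real.exp (-v⁻¹) * Real.exp v⁻¹ :=
          mul_le_mul_of_nonneg_left h2 (Real.exp_pos _).le
      _ = 1 := by rw [← Real.exp_add]; simp
  have key : ∀ a b : ℝ, a ≤ b → |b * expNegInvGlue b - a * expNegInvGlue a| ≤ b - a := by
    intro a b hab
    rcases le_or_gt b 0 with hb | hb
    · rw [expNegInvGlue.zero_of_nonpos hb, expNegInvGlue.zero_of_nonpos (hab.trans hb)]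
      simp only [mul_zero, sub_self, abs_zero, sub_nonneg, hab]
    rcases le_or_gt a 0 with ha | ha
    · rw [expNegInvGlue.zero_of_nonpos ha, mul_zero, sub_zero,
        abs_of_nonneg (mul_nonneg hb.le (expNegInvGlue.nonneg b))]
      linarith [mul_expNegInvGlue_le hb.le]
    · have h := hpos a b ha hb
      rw [one_mul, Real.norm_eq_abs, Real.norm_eq_abs, abs_of_nonneg (sub_nonneg.2 hab)] at h
      exact h
  refine LipschitzWith.of_dist_le_mul fun a b ↦ ?_
  rw [NNReal.coe_one, one_mul, Real.dist_eq, Real.dist_eq]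
  rcases le_total a b with hab | hab
  · rw [abs_sub_comm (a * expNegInvGlue a), abs_sub_comm a b, abs_of_nonneg (sub_nonneg.2 hab)]
    exact key a b hab
  · rw [abs_of_nonneg (sub_nonneg.2 hab)]
    exact key b a hab

/-! ## The smooth fold -/

/-- **A smooth antisymmetric fold.** For an odd test function `g` and `η > 0` there is an odd test
function `h` with `tsupport h ⊆ tsupport g` such that, for all `x, s > 0`,
`|h(s) − h(x)| ≤ |g(s) − g(x)|` and `|h(x)| ≤ |g(x)|`, and `|h(x) − sign(x)|g(x)|| ≤ 2η` for every
`x`. (On `x > 0`, `h = Ψ_η ∘ g` for a smooth radial `1`-Lipschitz `Ψ_η : ℂ → [0, ∞)` with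
`Ψ_η(z) = 0` for `|z| ≤ η` and `|z| − 2η ≤ Ψ_η(z) ≤ |z|`.) -/
theorem exists_smooth_fold {g : ℝ → ℂ} (hg : IsWeilTest g) (hgo : ∀ x, g (-x) = -g x) {η : ℝ}
    (hη : 0 < η) :
    ∃ h : ℝ → ℂ, IsWeilTest h ∧ (∀ x, h (-x) = -h x) ∧ tsupport h ⊆ tsupport g ∧
      (∀ x s, 0 < x → 0 < s → ‖h s - h x‖ ≤ ‖g s - g x‖) ∧
      (∀ x, 0 < x → ‖h x‖ ≤ ‖g x‖) ∧
      (∀ x, ‖h x - ((Real.sign x * ‖g x‖ : ℝ) : ℂ)‖ ≤ 2 * η) := by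
  -- the profile and the radial map
  set L : ℝ → ℝ := fun v ↦ v * expNegInvGlue v with hL
  have hLs : ContDiff ℝ ∞ L := contDiff_id.mul expNegInvGlue.contDiff
  have hL0 : ∀ v, v ≤ 0 → L v = 0 := fun v hv ↦ by
    simp only [hL, expNegInvGlue.zero_of_nonpos hv, mul_zero]
  have hLnn : ∀ v, 0 ≤ L v := fun v ↦ by
    rcases le_or_gt v 0 with h | h
    · rw [hL0 v h]
    · exact mul_nonneg h.le (expNegInvGlue.nonneg v)
  have hLlip : LipschitzWith 1 L := lipschitzWith_mul_expNegInvGlue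
  set Ψ : ℂ → ℝ := fun z ↦ η * L (‖z‖ / η - 1) with hΨ
  have hΨ0 : ∀ z : ℂ, ‖z‖ ≤ η → Ψ z = 0 := fun z hz ↦ by
    have : ‖z‖ / η - 1 ≤ 0 := by rw [sub_nonpos, div_le_one hη]; exact hz
    simp only [hΨ, hL0 _ this, mul_zero]
  have hΨnn : ∀ z, 0 ≤ Ψ z := fun z ↦ mul_nonneg hη.le (hLnn _)
  have hΨle : ∀ z, Ψ z ≤ ‖z‖ := fun z ↦ by
    rcases le_or_gt (‖z‖ / η - 1) 0 with h | h
    · simp only [hΨ, hL0 _ h, mul_zero, norm_nonneg]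
    · have h1 := mul_expNegInvGlue_le h.le
      have h2 : η * (‖z‖ / η - 1) = ‖z‖ - η := by field_simp
      calc Ψ z ≤ η * (‖z‖ / η - 1) := mul_le_mul_of_nonneg_left h1 hη.le
        _ = ‖z‖ - η := h2
        _ ≤ ‖z‖ := by linarith
  have hΨge : ∀ z, ‖z‖ - 2 * η ≤ Ψ z := fun z ↦ by
    have h1 := sub_one_le_mul_expNegInvGlue (‖z‖ / η - 1)
    have h2 : η * (‖z‖ / η - 1 - 1) = ‖z‖ - 2 * η := by field_simp; ring
    calc ‖z‖ - 2 * η = η * (‖z‖ / η - 1 - 1) := h2.symm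
      _ ≤ Ψ z := mul_le_mul_of_nonneg_left h1 hη.le
  have hΨlip : ∀ z w : ℂ, |Ψ z - Ψ w| ≤ ‖z - w‖ := fun z w ↦ by
    have h1 := hLlip.dist_le_mul (‖z‖ / η - 1) (‖w‖ / η - 1)
    rw [NNReal.coe_one, one_mul, Real.dist_eq, Real.dist_eq] at h1
    have h2 : |‖z‖ / η - 1 - (‖w‖ / η - 1)| = |‖z‖ - ‖w‖| / η := by
      rw [show ‖z‖ / η - 1 - (‖w‖ / η - 1) = (‖z‖ - ‖w‖) / η by ring, abs_div, abs_of_pos hη]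
    rw [h2] at h1
    have h3 : Ψ z - Ψ w = η * (L (‖z‖ / η - 1) - L (‖w‖ / η - 1)) := by simp only [hΨ]; ring
    rw [h3, abs_mul, abs_of_pos hη]
    calc η * |L (‖z‖ / η - 1) - L (‖w‖ / η - 1)| ≤ η * (|‖z‖ - ‖w‖| / η) :=
          mul_le_mul_of_nonneg_left h1 hη.le
      _ = |‖z‖ - ‖w‖| := by field_simp
      _ ≤ ‖z - w‖ := abs_norm_sub_norm_le z w
  have hΨneg : ∀ z, Ψ (-z) = Ψ z := fun z ↦ by simp only [hΨ, norm_neg]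
  have hΨs : ContDiff ℝ ∞ Ψ := by
    rw [contDiff_iff_contDiffAt]
    intro z
    by_cases hz : z = 0
    · -- `Ψ` vanishes on the ball of radius `η`
      have hev : Ψ =ᶠ[𝓝 z] fun _ ↦ 0 := by
        rw [hz]
        filter_upwards [Metric.ball_mem_nhds (0 : ℂ) hη] with w hw
        exact hΨ0 w (mem_ball_zero_iff.1 hw).le
      exact (contDiffAt_const (c := (0 : ℝ))).congr_of_eventuallyEq hev
    · have h1 : ContDiffAt ℝ ∞ (fun w : ℂ ↦ ‖w‖ / η - 1) z :=
        ((contDiffAt_norm ℂ hz).div_const η).sub contDiffAt_const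
      exact contDiffAt_const.mul (hLs.contDiffAt.comp z h1)
  -- the cutoff near the origin
  have hg0 : g 0 = 0 := by
    have h := hgo 0
    rw [neg_zero] at h
    exact CharZero.eq_neg_self_iff.1 h
  obtain ⟨δ, hδ, hδg⟩ : ∃ δ > 0, ∀ x : ℝ, |x| < δ → ‖g x‖ < η := by
    have hc : ContinuousAt g 0 := hg.1.continuous.continuousAt
    rcases Metric.continuousAt_iff.1 hc η hη with ⟨δ, hδ, h⟩
    refine ⟨δ, hδ, fun x hx ↦ ?_⟩
    have := h (by simpa [Real.dist_eq] using hx)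
    simpa [hg0, dist_eq_norm] using this
  set θ : ℝ → ℝ := fun x ↦ Real.smoothTransition (x / δ) - Real.smoothTransition (-x / δ) with hθ
  have hθs : ContDiff ℝ ∞ θ :=
    (Real.smoothTransition.contDiff.comp (contDiff_id.div_const δ)).sub
      (Real.smoothTransition.contDiff.comp (contDiff_neg.div_const δ))
  have hθodd : ∀ x, θ (-x) = -θ x := fun x ↦ by
    simp only [hθ, neg_neg]
    ring
  have hθ1 : ∀ x, δ ≤ x → θ x = 1 := fun x hx ↦ by
    have h1 : 1 ≤ x / δ := by rwa [le_div_iff₀ hδ, one_mul]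
    have h2 : -x / δ ≤ 0 := div_nonpos_of_nonpos_of_nonneg (by linarith) hδ.le
    simp only [hθ, Real.smoothTransition.one_of_one_le h1, Real.smoothTransition.zero_of_nonpos h2,
      sub_zero]
  -- the fold
  set h : ℝ → ℂ := fun x ↦ ((θ x * Ψ (g x) : ℝ) : ℂ) with hh
  have hpos : ∀ x, 0 < x → h x = ((Ψ (g x) : ℝ) : ℂ) := fun x hx ↦ by
    rcases le_or_gt δ x with h1 | h1
    · simp only [hh, hθ1 x h1, one_mul]
    · have : Ψ (g x) = 0 := hΨ0 _ (hδg x (by rwa [abs_of_pos hx])).le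
      simp only [hh, this, mul_zero]
  have hodd : ∀ x, h (-x) = -h x := fun x ↦ by
    simp only [hh, hθodd, hgo, hΨneg, neg_mul, Complex.ofReal_neg]
  refine ⟨h, ⟨?_, ?_⟩, hodd, ?_, ?_, ?_, ?_⟩
  · -- smoothness
    have h1 : ContDiff ℝ ∞ fun x ↦ Ψ (g x) := hΨs.comp hg.1
    exact Complex.ofRealCLM.contDiff.comp (hθs.mul h1)
  · -- compact support
    refine hg.2.mono fun x hx ↦ ?_
    rw [Function.mem_support] at hx ⊢
    intro h0
    apply hx
    simp only [hh, h0, hΨ0 0 (by simp [hη.le]), mul_zero, Complex.ofReal_zero]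
  · -- `tsupport h ⊆ tsupport g`
    refine closure_mono fun x hx ↦ ?_
    rw [Function.mem_support] at hx ⊢
    intro h0
    apply hx
    simp only [hh, h0, hΨ0 0 (by simp [hη.le]), mul_zero, Complex.ofReal_zero]
  · -- half-line contraction
    intro x s hx hs
    rw [hpos x hx, hpos s hs, ← Complex.ofReal_sub, Complex.norm_real, Real.norm_eq_abs]
    exact hΨlip _ _
  · -- domination
    intro x hx
    rw [hpos x hx, Complex.norm_real, Real.norm_of_nonneg (hΨnn _)]
    exact hΨle _
  · -- uniform closeness to `sign · |g|`
    have hp : ∀ x, 0 < x → ‖h x - ((Real.sign x * ‖g x‖ : ℝ) : ℂ)‖ ≤ 2 * η := fun x hx ↦ by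
      rw [hpos x hx, Real.sign_of_pos hx, one_mul, ← Complex.ofReal_sub, Complex.norm_real,
        Real.norm_eq_abs, abs_le]
      constructor <;> linarith [hΨle (g x), hΨge (g x)]
    intro x
    rcases lt_trichotomy x 0 with hx | hx | hx
    · have hy : 0 < -x := by linarith
      have h1 := hp (-x) hy
      rw [Real.sign_of_pos hy] at h1
      have e1 : h x = -h (-x) := by rw [hodd, neg_neg]
      have e2 : ‖g x‖ = ‖g (-x)‖ := by rw [hgo, norm_neg]
      rw [Real.sign_of_neg hx, e1, e2]
      calc ‖-h (-x) - (((-1 : ℝ) * ‖g (-x)‖ : ℝ) : ℂ)‖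
          = ‖-(h (-x) - (((1 : ℝ) * ‖g (-x)‖ : ℝ) : ℂ))‖ := by congr 1; push_cast; ring
        _ = ‖h (-x) - (((1 : ℝ) * ‖g (-x)‖ : ℝ) : ℂ)‖ := norm_neg _
        _ ≤ 2 * η := h1
    · subst hx
      have h0 : h 0 = 0 := by simp only [hh, hθ, neg_zero, sub_self, zero_mul, Complex.ofReal_zero]
      rw [h0, Real.sign_zero, zero_mul, Complex.ofReal_zero, sub_zero, norm_zero]
      positivity
    · exact hp x hx

end Summit.RiemannHypothesis.RiemannHypothesis.Theorems.OddArchAnchor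

end
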